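import Summits.BirchSwinnertonDyer.BirchSwinnertonDyer.Theorems.AdditiveBranchIMCGenusKolyvaginNonsplitSignCore
import Literature.NumberTheory.EllipticCurves.KodairaNeronMultiplicativeProofs
import Literature.NumberTheory.EllipticCurves.NonsplitNormalForm
import Literature.NumberTheory.EllipticCurves.LocalFrobeniusResidueProofs
import Literature.NumberTheory.EllipticCurves.KodairaNeronUnramified
import Literature.NumberTheory.GaloisRepresentations.MaxUnramifiedIntegers
import HarnessLib

/-!
# Route `AdditiveBranchIMC`, cruxes `GordTwoRankZeroOffCaseOne` (stmt-BirchSwinnertonDyer-19357) ∕ `MultLower` (19359),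
# lines `three_field_road` ∕ `tame_roads_mult`, stub `stub_nonsplitFrobeniusSign[M]` (L2): TRANSPORT TOOLS —
# the Frobenius on `𝒪ⁿʳ`, the tangent slopes of the non-split normal form over `𝒪ⁿʳ`, and `E₀(𝒪ⁿʳ) → E₀(𝒪_w)`

Cell `bsd-addord` (run/shared/lean/pub/bsd-addord/), seat `cruxlead-19357-g3` (continuation lead), HELPER
(`--supports stmt-BirchSwinnertonDyer-19357`). Skeleton v13 of both lines leaves ONE arithmetic stub,
`stub_nonsplitFrobeniusSign[M]` (at a non-split multiplicative place the arithmetic Frobenius `F` satisfies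
`F • Q + Q ∈ E⁰(K̄_v)` for every inertia-fixed `Q`; Silverman *ATAEC* Cor. IV.9.2 (d), Thm. IV.9.4 Step 2). Its
coordinate core is the tree theorem `GenusKolyvagin.NonsplitSign.hasNonsingularReduction_add_conj` (p681179, over
an abstract discrete valuation ring `R` with a tangent-swapping automorphism `σ`). This file supplies the three
pieces of PLUMBING that instantiate the core at `R = 𝒪ⁿʳ`, the valuation ring of the maximal unramified extension
`K_v^nr ⊆ K̄_v` (tree `MaxUnramifiedIntegersProofs`: a henselian discrete valuation ring; written, as there, as the
expression `(w.comap (algebraMap K_v^nr K̄_v)).valuationSubring`, `w` the spectral valuation, `hw`):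

* §1 `exists_ringEquiv_unrIntegers_smul` — every `F ∈ Γ_{K_v}` restricts to a ring AUTOMORPHISM `σ` of `𝒪ⁿʳ`
  with `σ r = F • r` in `K̄_v` (`K_v^nr` is `Γ_{K_v}`-stable, `smul_mem_maxUnramified`; `F` is a `w`-isometry,
  `spectralValuation_smul`); `σ` fixes the image of `𝓞_v` (`ringEquiv_unrIntegers_map_eq`).
* §2 `exists_slopes_of_residue_root` — over a henselian local ring, if `b₂ = a₁² + 4a₂` is a unit and the tangent
  form `T² + ā₁T − ā₂` has a root in the residue field, then it splits over the ring as `(T − ρ)(T − ρ′)` with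
  `ρ + ρ′ = −a₁`, `ρρ′ = −a₂`, `ρ′ − ρ` a unit (Hensel); and `exists_slopes_unrIntegers` — for the non-split normal
  form `J` (`a₃ = a₄ = 0`, `a₆ ∈ 𝔪`, `b₂ ∈ 𝒪ⁿʳˣ`) over `𝒪ⁿʳ` the residue root exists (the node of `J` is split over
  `𝒪ⁿʳ`: tree `exists_splitNode_root_unrIntegers`, `c₄ = b₂²`, `Δ = −a₆(b₂³ + 432a₆) ∈ 𝔪`).
* §3 `reducesToNonsingular_map_congrEquiv_of_hasNonsingularReduction` — **`E₀` over `𝒪ⁿʳ` maps into `E₀` for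
  `|·|_v`**: for `J` over `𝒪ⁿʳ` and `X` over `K_v` with `J ⊗ K_v^nr = X ⊗ K_v^nr`, a point of `J(K_v^nr)` with
  nonsingular reduction, pushed into `X(K̄_v)`, `ReducesToNonsingular` for `w` — Step (4) of the tree's
  `ordΔ_nsmul_reducesToNonsingular_of_hasMultiplicativeReduction` / `exists_rational_generator_of_tateNormalForm`,
  isolated as a lemma (it was so far repeated verbatim inside each consumer).

THEOREMS ONLY; no `sorry`; nothing about BSD is proved here; the cruxes stay OPEN. The sign theorem itself
(`frobenius_map_add_reducesToNonsingular_of_nonsplitNormalForm`) and its receptacle form are the sequel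
`AdditiveBranchIMCGenusKolyvaginNonsplitSign`.

References: [cite: NeukirchANT1999, Ch. II (4.6), (7.5), Def. (9.10), Prop. (9.11)] [cite: SilvermanAEC2009, VII.§2
Prop. 2.1, VII.§5 Prop. 5.1] [cite: SilvermanATAEC1994, IV.9.4 Step 2].

presearch: «Frobenius restricted to the maximal unramified extension; tangent slopes of a node over K^nr;
E₀(K^nr) inside E₀(K̄)» → [corpus: NeukirchANT1999 II §9] / [corpus: SilvermanAEC2009 VII.2] statement level only;
tree `MaxUnramifiedIntegersProofs`, `KodairaNeronMultiplicativeProofs`, `TateNormalFormUnramifiedComponentsProofs`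
hold the ingredients (re-used here by name); galaxy "maximal unramified|Frobenius|valuation ring" → textbook pages.
-/

noncomputable section

open scoped Classical NNReal
open NumberField IsDedekindDomain Field Polynomial IsLocalRing

universe u

set_option linter.dupNamespace false

namespace Summit.BirchSwinnertonDyer.BirchSwinnertonDyer.Theorems.GenusKolyvagin.NonsplitSign

open Literature.NumberTheory.EllipticCurves Literature.NumberTheory.EllipticCurves.LocalIndex
  Literature.NumberTheory.GaloisRepresentations
  Literature.NumberTheory.GaloisRepresentations.IsNonarchimedeanLocalField
  IsDedekindDomain.HeightOneSpectrum

/-! ## §2 (abstract part). Tangent slopes from a residue root, over a henselian local ring -/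

section Henselian

variable {S : Type*} [CommRing S] [HenselianLocalRing S]

/-- **The tangent form splits over a henselian ring as soon as it has a residue root and unit discriminant.**
For a Weierstrass equation `J` over a henselian local ring `S` with `b₂ = a₁² + 4a₂ ∈ Sˣ` and a root `μ` of
`T² + ā₁T − ā₂` in the residue field, there are `ρ, ρ′ ∈ S` with `ρ + ρ′ = −a₁`, `ρρ′ = −a₂` and `ρ′ − ρ ∈ Sˣ`
(`(T − ρ)(T − ρ′) = T² + a₁T − a₂`): Hensel's lemma at a lift of `μ`, the derivative `2μ + a₁` being a unit
because `(2μ + a₁)² ≡ b₂`; then `ρ′ = −a₁ − ρ` and `(ρ′ − ρ)² = b₂`. (Silverman *AEC* VII.§5: the slopes of the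
tangent lines at the node.) [folklore] -/
theorem exists_slopes_of_residue_root (J : WeierstrassCurve S) (hb₂ : IsUnit J.b₂)
    (hμ : ∃ μ : ResidueField S, μ ^ 2 + residue S J.a₁ * μ - residue S J.a₂ = 0) :
    ∃ ρ ρ' : S, ρ + ρ' = -J.a₁ ∧ ρ * ρ' = -J.a₂ ∧ IsUnit (ρ' - ρ) := by
  obtain ⟨μ, hμ⟩ := hμ
  obtain ⟨μ₀, rfl⟩ := IsLocalRing.residue_surjective μ
  set g : S[X] := X ^ 2 + C J.a₁ * X - C J.a₂ with hg
  have hev : ∀ t, g.eval t = t ^ 2 + J.a₁ * t - J.a₂ := by intro t; simp [hg]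
  have hev' : ∀ t, g.derivative.eval t = 2 * t + J.a₁ := by
    intro t
    simp only [hg, derivative_sub, derivative_add, derivative_mul, derivative_C, zero_mul,
      derivative_X_pow, zero_add, derivative_X, mul_one, eval_add, eval_mul, eval_C, eval_X,
      eval_pow, Nat.cast_ofNat, sub_zero]
    ring
  have hb₂def : J.b₂ = J.a₁ ^ 2 + 4 * J.a₂ := rfl
  have hg0 : g.eval μ₀ ∈ maximalIdeal S := by
    rw [← IsLocalRing.residue_eq_zero_iff, hev, map_sub, map_add, map_mul, map_pow]
    exact hμ
  have hg1 : IsUnit (g.derivative.eval μ₀) := by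
    rw [hev']
    have hsq : (2 * μ₀ + J.a₁) ^ 2 = 4 * g.eval μ₀ + J.b₂ := by rw [hev, hb₂def]; ring
    have hu : IsUnit ((2 * μ₀ + J.a₁) ^ 2) := by
      rw [hsq]
      refine IsLocalRing.notMem_maximalIdeal.mp fun hmem ↦ IsLocalRing.notMem_maximalIdeal.mpr hb₂ ?_
      have := Ideal.sub_mem _ hmem (Ideal.mul_mem_left _ 4 hg0)
      rwa [add_sub_cancel_left] at this
    exact (isUnit_pow_iff two_ne_zero).mp hu
  obtain ⟨ρ, hρ, -⟩ := HenselianLocalRing.exists_isRoot_of_isUnit_derivative g μ₀ hg0 hg1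
  have hρ' : ρ ^ 2 + J.a₁ * ρ - J.a₂ = 0 := by rw [← hev]; exact hρ.eq_zero
  refine ⟨ρ, -J.a₁ - ρ, by ring, by linear_combination (-1 : S) * hρ', ?_⟩
  have hsq : (-J.a₁ - ρ - ρ) ^ 2 = J.b₂ := by
    rw [hb₂def]; linear_combination (4 : S) * hρ'
  exact (isUnit_pow_iff two_ne_zero).mp (hsq ▸ hb₂)

/-- For a Weierstrass equation with `a₃ = a₄ = 0`: `c₄ = b₂²` and `Δ = −a₆ (b₂³ + 432 a₆)`. [folklore] -/
theorem c₄_eq_and_Δ_eq_of_a₃_a₄ {S : Type*} [CommRing S] (J : WeierstrassCurve S) (h3 : J.a₃ = 0)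
    (h4 : J.a₄ = 0) : J.c₄ = J.b₂ ^ 2 ∧ J.Δ = -(J.a₆ * (J.b₂ ^ 3 + 432 * J.a₆)) := by
  have hb₄ : J.b₄ = 0 := by rw [WeierstrassCurve.b₄, h3, h4]; ring
  have hb₆ : J.b₆ = 4 * J.a₆ := by rw [WeierstrassCurve.b₆, h3]; ring
  have hb₈ : J.b₈ = J.b₂ * J.a₆ := by rw [WeierstrassCurve.b₈, WeierstrassCurve.b₂, h3, h4]; ring
  refine ⟨?_, ?_⟩
  · rw [show J.c₄ = J.b₂ ^ 2 - 24 * J.b₄ from rfl, hb₄]; ring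
  · rw [show J.Δ = -J.b₂ ^ 2 * J.b₈ - 8 * J.b₄ ^ 3 - 27 * J.b₆ ^ 2 + 9 * J.b₂ * J.b₄ * J.b₆ from rfl,
      hb₄, hb₆, hb₈]; ring

end Henselian

variable {K : Type u} [Field K] [NumberField K] {v : HeightOneSpectrum (𝓞 K)}
  {w : Valuation (AlgebraicClosure (v.adicCompletion K)) ℝ≥0}
  (hw : ∀ x, (w x : ℝ) = spectralNorm (v.adicCompletion K) (AlgebraicClosure (v.adicCompletion K)) x)

/-! ## §1 The Frobenius (indeed any `F ∈ Γ_{K_v}`) as a ring automorphism of `𝒪ⁿʳ` -/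

include hw in
/-- **Every `F ∈ Γ_{K_v}` restricts to a ring automorphism of `𝒪ⁿʳ`.** `K_v^nr = K_v(μ_{p′})` is stable under
`Γ_{K_v}` (tree `smul_mem_maxUnramified`) and `F` preserves `|·|_v` (tree `spectralValuation_smul`), so
`r ↦ F • r` is a ring automorphism `σ` of `𝒪ⁿʳ = {x ∈ K_v^nr : |x|_v ≤ 1}` (inverse `r ↦ F⁻¹ • r`), with
`σ r = F • r` in `K̄_v`. Neukirch, *ANT*, II §9 (the decomposition group acts on the inertia field). [folklore] -/
theorem exists_ringEquiv_unrIntegers_smul (F : absoluteGaloisGroup (v.adicCompletion K)) :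
    ∃ σ : (Valuation.valuationSubring (Valuation.comap (algebraMap (maxUnramified (v.adicCompletion K)) (AlgebraicClosure (v.adicCompletion K))) w)) ≃+*
        (Valuation.valuationSubring (Valuation.comap (algebraMap (maxUnramified (v.adicCompletion K)) (AlgebraicClosure (v.adicCompletion K))) w)),
      ∀ r, (((σ r : (Valuation.valuationSubring (Valuation.comap (algebraMap (maxUnramified (v.adicCompletion K)) (AlgebraicClosure (v.adicCompletion K))) w))) : maxUnramified (v.adicCompletion K)) : AlgebraicClosure (v.adicCompletion K)) =
        F • (((r : maxUnramified (v.adicCompletion K))) : AlgebraicClosure (v.adicCompletion K)) := by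
  -- membership of `τ • x` in `K_v^nr` and in `𝒪ⁿʳ`
  have hmem : ∀ (τ : absoluteGaloisGroup (v.adicCompletion K))
      (r : (Valuation.valuationSubring (Valuation.comap (algebraMap (maxUnramified (v.adicCompletion K)) (AlgebraicClosure (v.adicCompletion K))) w))),
      τ • (((r : maxUnramified (v.adicCompletion K))) : AlgebraicClosure (v.adicCompletion K)) ∈ maxUnramified (v.adicCompletion K) :=
    fun τ r ↦ smul_mem_maxUnramified τ (r : maxUnramified (v.adicCompletion K)).2
  have hle : ∀ (τ : absoluteGaloisGroup (v.adicCompletion K))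
      (r : (Valuation.valuationSubring (Valuation.comap (algebraMap (maxUnramified (v.adicCompletion K)) (AlgebraicClosure (v.adicCompletion K))) w))),
      (⟨_, hmem τ r⟩ : maxUnramified (v.adicCompletion K)) ∈
        (Valuation.valuationSubring (Valuation.comap (algebraMap (maxUnramified (v.adicCompletion K)) (AlgebraicClosure (v.adicCompletion K))) w)) := by
    intro τ r
    rw [Valuation.mem_valuationSubring_iff, comap_maxUnramified_apply]
    change w (τ • _) ≤ 1
    rw [spectralValuation_smul hw]
    exact coe_unrIntegers_le_one r
  let f : ∀ _ : absoluteGaloisGroup (v.adicCompletion K),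
      (Valuation.valuationSubring (Valuation.comap (algebraMap (maxUnramified (v.adicCompletion K)) (AlgebraicClosure (v.adicCompletion K))) w)) →
        (Valuation.valuationSubring (Valuation.comap (algebraMap (maxUnramified (v.adicCompletion K)) (AlgebraicClosure (v.adicCompletion K))) w)) :=
    fun τ r ↦ ⟨⟨_, hmem τ r⟩, hle τ r⟩
  have hf : ∀ τ r, (((f τ r : (Valuation.valuationSubring (Valuation.comap (algebraMap (maxUnramified (v.adicCompletion K)) (AlgebraicClosure (v.adicCompletion K))) w))) : maxUnramified (v.adicCompletion K)) : AlgebraicClosure (v.adicCompletion K)) =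
      τ • (((r : maxUnramified (v.adicCompletion K))) : AlgebraicClosure (v.adicCompletion K)) := fun _ _ ↦ rfl
  have hinj : ∀ r s : (Valuation.valuationSubring (Valuation.comap (algebraMap (maxUnramified (v.adicCompletion K)) (AlgebraicClosure (v.adicCompletion K))) w)),
      (((r : maxUnramified (v.adicCompletion K))) : AlgebraicClosure (v.adicCompletion K)) =
        (((s : maxUnramified (v.adicCompletion K))) : AlgebraicClosure (v.adicCompletion K)) → r = s :=
    fun r s h ↦ Subtype.ext (Subtype.ext h)
  let σ : (Valuation.valuationSubring (Valuation.comap (algebraMap (maxUnramified (v.adicCompletion K)) (AlgebraicClosure (v.adicCompletion K))) w)) ≃+*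
      (Valuation.valuationSubring (Valuation.comap (algebraMap (maxUnramified (v.adicCompletion K)) (AlgebraicClosure (v.adicCompletion K))) w)) :=
    { toFun := f F
      invFun := f F⁻¹
      left_inv := fun r ↦ hinj _ _ (by rw [hf, hf, inv_smul_smul])
      right_inv := fun r ↦ hinj _ _ (by rw [hf, hf, smul_inv_smul])
      map_mul' := fun r s ↦ hinj _ _ (by rw [hf]; push_cast; rw [smul_mul', hf, hf])
      map_add' := fun r s ↦ hinj _ _ (by rw [hf]; push_cast; rw [smul_add, hf, hf]) }
  exact ⟨σ, fun r ↦ hf F r⟩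

/-- A ring automorphism of `𝒪ⁿʳ` acting as `F ∈ Γ_{K_v}` in `K̄_v` fixes the image of `𝓞_v` (`F` is
`K_v`-linear). [folklore] -/
theorem ringEquiv_unrIntegers_map_eq {F : absoluteGaloisGroup (v.adicCompletion K)}
    {σ : (Valuation.valuationSubring (Valuation.comap (algebraMap (maxUnramified (v.adicCompletion K)) (AlgebraicClosure (v.adicCompletion K))) w)) ≃+*
        (Valuation.valuationSubring (Valuation.comap (algebraMap (maxUnramified (v.adicCompletion K)) (AlgebraicClosure (v.adicCompletion K))) w))}
    (hσ : ∀ r, (((σ r : (Valuation.valuationSubring (Valuation.comap (algebraMap (maxUnramified (v.adicCompletion K)) (AlgebraicClosure (v.adicCompletion K))) w))) : maxUnramified (v.adicCompletion K)) : AlgebraicClosure (v.adicCompletion K)) =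
        F • (((r : maxUnramified (v.adicCompletion K))) : AlgebraicClosure (v.adicCompletion K)))
    {φ : v.adicCompletionIntegers K →+* (Valuation.valuationSubring (Valuation.comap (algebraMap (maxUnramified (v.adicCompletion K)) (AlgebraicClosure (v.adicCompletion K))) w))}
    (hφ : ∀ a, (((φ a : (Valuation.valuationSubring (Valuation.comap (algebraMap (maxUnramified (v.adicCompletion K)) (AlgebraicClosure (v.adicCompletion K))) w))) : (maxUnramified (v.adicCompletion K))) : (AlgebraicClosure (v.adicCompletion K))) = algebraMap (v.adicCompletion K) (AlgebraicClosure (v.adicCompletion K)) (a : (v.adicCompletion K)))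
    (a : v.adicCompletionIntegers K) : σ (φ a) = φ a := by
  refine Subtype.ext (Subtype.ext ?_)
  rw [hσ, hφ, absoluteGaloisGroup.smul_def, AlgEquiv.commutes]

/-! ## §2 (concrete part). The tangent slopes of the non-split normal form over `𝒪ⁿʳ` -/

include hw in
set_option maxHeartbeats 1600000 in
/-- **Over `𝒪ⁿʳ` the tangent form of the non-split normal form splits.** For `J` over `𝒪ⁿʳ` with `a₃ = a₄ = 0`,
`a₆ ∈ 𝔪ⁿʳ` and `b₂ ∈ 𝒪ⁿʳˣ` (the image of the tree's `NonsplitNormalForm` of a multiplicative place) there are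
`ρ, ρ′ ∈ 𝒪ⁿʳ` with `ρ + ρ′ = −a₁`, `ρρ′ = −a₂`, `ρ′ − ρ ∈ 𝒪ⁿʳˣ`: the node of `J` is split over `𝒪ⁿʳ` (tree
`exists_splitNode_root_unrIntegers`, applicable as `c₄ = b₂² ∉ 𝔪ⁿʳ`, `Δ = −a₆(b₂³ + 432a₆) ∈ 𝔪ⁿʳ`; for
`a₃ = a₄ = a₆ ≡ 0` the node polynomial is `b̄₂²(T² + ā₁T − ā₂)`, tree `eval_nodePoly_of_a₃₄₆`), and `𝒪ⁿʳ` is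
henselian (`exists_slopes_of_residue_root`). Silverman, *AEC*, VII.5.1 and Exercise 3.5; Neukirch, *ANT*,
II (9.11) (`K_v^nr` has separably closed residue field). [folklore] -/
theorem exists_slopes_unrIntegers
    [HenselianLocalRing (Valuation.valuationSubring (Valuation.comap (algebraMap (maxUnramified (v.adicCompletion K)) (AlgebraicClosure (v.adicCompletion K))) w))]
    (J : WeierstrassCurve (Valuation.valuationSubring (Valuation.comap (algebraMap (maxUnramified (v.adicCompletion K)) (AlgebraicClosure (v.adicCompletion K))) w)))
    (h3 : J.a₃ = 0) (h4 : J.a₄ = 0)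
    (h6 : J.a₆ ∈ maximalIdeal (Valuation.valuationSubring (Valuation.comap (algebraMap (maxUnramified (v.adicCompletion K)) (AlgebraicClosure (v.adicCompletion K))) w)))
    (hb₂ : IsUnit J.b₂) :
    ∃ ρ ρ' : (Valuation.valuationSubring (Valuation.comap (algebraMap (maxUnramified (v.adicCompletion K)) (AlgebraicClosure (v.adicCompletion K))) w)),
      ρ + ρ' = -J.a₁ ∧ ρ * ρ' = -J.a₂ ∧ IsUnit (ρ' - ρ) := by
  obtain ⟨hc₄, hΔ⟩ := c₄_eq_and_Δ_eq_of_a₃_a₄ J h3 h4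
  have hΔm : J.Δ ∈ maximalIdeal _ := by
    rw [hΔ]
    have h6' := Ideal.mul_mem_right (J.b₂ ^ 3 + 432 * J.a₆) (maximalIdeal _) h6
    exact neg_mem h6'
  have hc₄m : J.c₄ ∉ maximalIdeal _ := by
    rw [hc₄]
    exact IsLocalRing.notMem_maximalIdeal.mpr (hb₂.pow 2)
  obtain ⟨μ, hμ⟩ := exists_splitNode_root_unrIntegers hw J hΔm hc₄m
  refine exists_slopes_of_residue_root J hb₂ ⟨μ, ?_⟩
  have hJ3 : (J.map (residue _)).a₃ = 0 := by rw [WeierstrassCurve.map_a₃, h3, map_zero]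
  have hJ4 : (J.map (residue _)).a₄ = 0 := by rw [WeierstrassCurve.map_a₄, h4, map_zero]
  have hJ6 : (J.map (residue _)).a₆ = 0 := by
    rw [WeierstrassCurve.map_a₆, (IsLocalRing.residue_eq_zero_iff _).mpr h6]
  have hP := eval_nodePoly_of_a₃₄₆ (J.map (residue _)) hJ3 hJ4 hJ6 μ
  rw [hμ] at hP
  have hb₂' : (J.map (residue _)).b₂ ^ 2 ≠ 0 := by
    rw [WeierstrassCurve.map_b₂]
    exact pow_ne_zero 2 ((IsLocalRing.residue_ne_zero_iff_isUnit _).mpr hb₂)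
  have h0 := (mul_eq_zero.mp hP.symm).resolve_left hb₂'
  rw [WeierstrassCurve.map_a₁, WeierstrassCurve.map_a₂] at h0
  exact h0

/-! ## §3 `E₀` over `𝒪ⁿʳ` maps into `E₀` for `|·|_v` -/

/-- **A point of `J(K_v^nr)` with nonsingular reduction over `𝒪ⁿʳ` reduces to a nonsingular point for `|·|_v`
in `X(K̄_v)`**, for a Weierstrass equation `J` over `𝒪ⁿʳ` and `X` over `K_v` with `J ⊗ K_v^nr = X ⊗ K_v^nr`
(the point being moved along this equality and `K_v^nr ⊆ K̄_v`). Three cases (`point_cases`): `𝒪`; a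
non-integral point (`|x|_v > 1`, it reduces to `𝒪`); an integral point `(a, b)`, `a, b ∈ 𝒪ⁿʳ`, whose reduction on
`J mod 𝔪ⁿʳ` is nonsingular — read on the `𝒪_w`-model `J ⊗ 𝒪_w` of `X ⊗ K̄_v`
(`reducesToNonsingular_iff_hasNonsingularReduction`), where the residue field of `𝒪ⁿʳ` embeds into that of `𝒪_w`
(`ψ : 𝒪ⁿʳ → 𝒪_w` is local) and nonsingularity is preserved (Mathlib `Affine.map_nonsingular`). This is Step (4)
of the tree's `ordΔ_nsmul_reducesToNonsingular_of_hasMultiplicativeReduction`, isolated. Silverman, *AEC*,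
VII.§2 Prop. 2.1. [cite: SilvermanAEC2009, VII.§2 Prop. 2.1] -/
theorem reducesToNonsingular_map_congrEquiv_of_hasNonsingularReduction
    (J : WeierstrassCurve (Valuation.valuationSubring (Valuation.comap (algebraMap (maxUnramified (v.adicCompletion K)) (AlgebraicClosure (v.adicCompletion K))) w)))
    (X : WeierstrassCurve (v.adicCompletion K))
    (hJ : J.baseChange (maxUnramified (v.adicCompletion K)) = X.baseChange (maxUnramified (v.adicCompletion K)))
    {Q : (J.baseChange (maxUnramified (v.adicCompletion K))).toAffine.Point} (hQ : J.HasNonsingularReduction Q) :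
    letI : DecidableEq (maxUnramified (v.adicCompletion K)) := fun a b ↦ Classical.propDecidable (a = b)
    ReducesToNonsingular w (residue w.integer)
      (WeierstrassCurve.Affine.Point.map (W' := X)
        (IsScalarTower.toAlgHom (v.adicCompletion K) (maxUnramified (v.adicCompletion K)) (AlgebraicClosure (v.adicCompletion K)))
        (WeierstrassCurve.Affine.Point.congrEquiv hJ Q)) := by
  -- the classical decidable equality on `K_v^nr`, as in the index theorems of the tree
  letI instDec : DecidableEq (maxUnramified (v.adicCompletion K)) := fun a b ↦ Classical.propDecidable (a = b)
  obtain ⟨ψ, hψ⟩ := exists_ringHom_unrIntegers_integer (w := w) (v := v) (K := K)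
  have hvR := integers_valuationRing_valuation (Valuation.valuationSubring (Valuation.comap (algebraMap (maxUnramified (v.adicCompletion K)) (AlgebraicClosure (v.adicCompletion K))) w)) (maxUnramified (v.adicCompletion K))
  have hinjR := IsFractionRing.injective (Valuation.valuationSubring (Valuation.comap (algebraMap (maxUnramified (v.adicCompletion K)) (AlgebraicClosure (v.adicCompletion K))) w)) (maxUnramified (v.adicCompletion K))
  -- the `𝒪_w`-model `J ⊗ 𝒪_w` of `X ⊗ K̄_v`
  have hW₀ : (J.map ψ).baseChange (AlgebraicClosure (v.adicCompletion K)) = X.baseChange (AlgebraicClosure (v.adicCompletion K)) := by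
    have h1 : (J.map ψ).baseChange (AlgebraicClosure (v.adicCompletion K)) =
        (J.baseChange (maxUnramified (v.adicCompletion K))).baseChange (AlgebraicClosure (v.adicCompletion K)) := by
      change (J.map ψ).map (algebraMap _ _) = (J.map (algebraMap _ _)).map (algebraMap _ _)
      rw [WeierstrassCurve.map_map, WeierstrassCurve.map_map]
      congr 1
      refine RingHom.ext fun a ↦ ?_
      change ((ψ a : w.integer) : (AlgebraicClosure (v.adicCompletion K))) = ((algebraMap _ (maxUnramified (v.adicCompletion K)) a : maxUnramified (v.adicCompletion K)) : AlgebraicClosure (v.adicCompletion K))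
      rw [hψ]
      rfl
    rw [h1, hJ]
    change (X.map (algebraMap _ _)).map (algebraMap _ _) = X.map (algebraMap _ _)
    rw [WeierstrassCurve.map_map, ← IsScalarTower.algebraMap_eq]
  -- `ψ` is local: the residue field of `𝒪ⁿʳ` embeds into that of `𝒪_w`
  haveI hψloc : IsLocalHom ψ := ⟨fun a ha ↦ by
    by_contra hna
    have hmem : a ∈ maximalIdeal (Valuation.valuationSubring (Valuation.comap (algebraMap (maxUnramified (v.adicCompletion K)) (AlgebraicClosure (v.adicCompletion K))) w)) :=
      (IsLocalRing.mem_maximalIdeal _).mpr (mem_nonunits_iff.mpr hna)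
    have := (map_mem_maximalIdeal_integer_iff hψ a).mpr hmem
    exact (mem_nonunits_iff.mp ((IsLocalRing.mem_maximalIdeal _).mp this)) ha⟩
  have hκ : (J.map ψ).map (residue w.integer) =
      ((J.map (residue (Valuation.valuationSubring (Valuation.comap (algebraMap (maxUnramified (v.adicCompletion K)) (AlgebraicClosure (v.adicCompletion K))) w)))).map
        (IsLocalRing.ResidueField.map ψ)) := by
    simp only [WeierstrassCurve.map_map]
    congr 1
  set ι : (X.baseChange (maxUnramified (v.adicCompletion K))).toAffine.Point →+ (X.baseChange (AlgebraicClosure (v.adicCompletion K))).toAffine.Point :=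
    WeierstrassCurve.Affine.Point.map (W' := X)
      (IsScalarTower.toAlgHom (v.adicCompletion K) (maxUnramified (v.adicCompletion K)) (AlgebraicClosure (v.adicCompletion K))) with hι
  set e₁ := WeierstrassCurve.Affine.Point.congrEquiv hJ with he₁
  rcases point_cases hvR Q with rfl | ⟨x, y, h, rfl, hx⟩ | ⟨a, b, h, rfl⟩
  · rw [map_zero, map_zero]
    exact reducesToNonsingular_zero
  · have hx' : 1 < w (x : (AlgebraicClosure (v.adicCompletion K))) := not_le.mp fun hle ↦
      (not_mem_range_iff hvR).mpr hx ⟨⟨x, (Valuation.mem_valuationSubring_iff _ _).mpr hle⟩, rfl⟩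
    rw [he₁, WeierstrassCurve.Affine.Point.congrEquiv_some]
    exact reducesToNonsingular_of_one_lt hx'
  · have hns := (WeierstrassCurve.hasNonsingularReduction_some_algebraMap_iff hinjR h).mp hQ
    rw [he₁, WeierstrassCurve.Affine.Point.congrEquiv_some]
    -- transport to the `𝒪_w`-model `J ⊗ 𝒪_w` of `X ⊗ K̄ᵥ`
    rw [← (WeierstrassCurve.Affine.Point.congrEquiv hW₀).apply_symm_apply (ι _),
      reducesToNonsingular_congrEquiv_iff, reducesToNonsingular_iff_hasNonsingularReduction]
    change (J.map ψ).HasNonsingularReduction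
      ((WeierstrassCurve.Affine.Point.congrEquiv hW₀).symm (WeierstrassCurve.Affine.Point.some _ _ _))
    rw [WeierstrassCurve.Affine.Point.congrEquiv_symm_some]
    refine Or.inr ⟨ψ a, ψ b, hψ a, hψ b, ?_⟩
    rw [hκ, ← IsLocalRing.ResidueField.map_residue, ← IsLocalRing.ResidueField.map_residue]
    exact (WeierstrassCurve.Affine.map_nonsingular _
      (IsLocalRing.ResidueField.map ψ).injective _ _).mpr hns

end Summit.BirchSwinnertonDyer.BirchSwinnertonDyer.Theorems.GenusKolyvagin.NonsplitSign

end
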